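import Summits.QuantumFields.BalabanUV.Beta.D1BFx.ReducedKernelF

/-!
# `BalabanUV.Beta.D1BFx.PackedKernelSplit` — road «BF-x» for binder row D1, sub-leaf K-R2-SPLIT: THE TERM SPLIT OF THE ONE-LOOP
# KERNEL OF A PACKED (field ⊕ multiplier) RESOLVENT INTO ITS FIELD–FIELD PART PLUS AN EXPLICIT FINITE LIST OF BLOCK TERMS —
# `hessKer K V W μ ν z = hessKer (blk K ff) (V·ff) (W·ff) μ ν z + blockTerms K V W μ ν z`, generic in the packed kernel `K`

HONEST DEPENDENCY (page 1, mandatory): continuum YM on T⁴ ⇐ BetaPertH ∧ nine spine estimates (0/9 proved); BetaPertH ⇐ (D1) ∧ (D4) ∧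
CAP+tail; G-an2-4 gates asym, D1 and NE2/3/4.  HONEST FRAMING (cell contract, verbatim): «discharging `BetaPertH` makes Bałaban's UV
stability UNCONDITIONAL — a real constructive-QFT result; it is NOT the continuum limit and NOT the Clay problem.»  THIS MODULE DISCHARGES
NOTHING of D1 / BetaPertH: it is [folklore] kernel bookkeeping over `ExpKernelCalculus` / `TameKernelCalculus` (Fubini over a finite fibre sum,
additivity of `comp`/`tr` for tame resp. localised factors) plus small [our object] definitions (`inj`, `blk`, `packK`, `biBubble`, `ffV`, `ffW`,
`blockTerms`, `legCross` — data, asserting nothing).  No `def … : Prop`, no citation, no printed statement as hypothesis; 0 binders of the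
hR/hW roots touched.  NOT summit progress; NOT BetaPertH, NOT continuum, NOT Clay.
ABSOLUTE RULE (cell charter, verbatim): «No internally-minted statement may enter as a cited fact. Every hypothesis is either
kernel-proved in this package or a verbatim quotation of a PUBLISHED theorem with page reference. The manuscript(s) under audit are NOT
citable for their own disputed steps — they are the thing under adjudication; programme-internal (2001/route/tribunal) claims are never
citable.»

WHY (owner ruling R-1 of `HOME/b2b-balaban-beta-d1-p2/OWNER-RULINGS-1.md` ⇒ (R2-a); TYPER-SPEC §2 K-R2 «CONSEQUENCE (the term split of node A, by
pure substitution): `hessKer (…) (vertexOf S) W = hessKerRed + blockTerms` with `blockTerms` an explicit FINITE sum»; claim table `LEAVES-BFx.md`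
row K-R2, sub-leaf K-R2-SPLIT).  The typed one-shot kernel of the cell is `OneStepResolventKernel.TOf J = hessKer (KInv N) (vertexOf J.S) J.W`
over the PACKED resolvent `KInv : MKer (d+1) (Fib d)`, `Fib d = Fin (d+1) ⊕ Fin (d+1)`, whose four blocks are (ff) the fluctuation covariance
`Γ`, (fm)/(mf) the `ℋ`-columns, (mm) the multiplier response.  Under (R2-a) the R-WEIGHTED bordered system of road BF-x has a packed kernel of
the SAME shape with only the ff letter changed (`Γ_R := Ga − Ga·Qᵀ·Cun·Q·Ga`, the owner's / K-R1's letter — NOT defined or asserted here; the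
fm/mf/mm blocks coincide with the typed ones at model level by `GaugeFixingPropagators.blocks_add_weight`, the kernel-level identification is
K-R1's).  Node A needs the kernel as «bubble/tadpole over the ff leg with the ff blocks of the stencils» PLUS the finitely many words with an
`ℋ`-leg or a multiplier leg (A3.d / A5), and, for an ff leg `Ga − B`, the cross words in `B`; both splits are proved ONCE here, for every `K`.

CONTENT.
* §1 [our objects] `inj` (`true ↦ inl` = field, `false ↦ inr` = multiplier), block reader `blk K i j`, packer `packK`, `biBubble A V B W :=
  tr ((A∘V)∘(B∘W))`; [folklore] `blk_packK_*`, `packK_blk`, inheritance `decays_blk`/`biLoc_blk`/`spr_blk`/`loc_blk`/`tame_blk`, `decays_packK`.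
* §2 [folklore] FUBINI OVER THE FIBRE: **`blk_comp`** (`blk (A∘B) i k = A_i·true ∘ B_true·k + A_i·false ∘ B_false·k`, tame factors), **`tr_eq_blk`**
  (`tr K = tr K_ff + tr K_mm`, localised `K`), `tr_comp_eq_blk_sum`, **`tadpole_eq_blk_sum`** (4 words), `tr_comp_add_add`, **`bubble_eq_blk_sum`**
  (16 words).
* §3 [our object] `blockTerms K V W μ ν z` = ½·(the 3 tadpole words with a non-ff block of `K`) − ½·(the 15 bubble words with a non-ff block of
  `K`), displayed as guarded finite sums; [folklore] **`hessKer_eq_ff_add_blockTerms`** (spread `K`, localised vertex/table entries).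
* §4 [our object] `legCross A B V W`; [folklore] **`hessKer_add_leg`**: `hessKer (A + B) V W = hessKer A V W + legCross A B V W` (spread legs).
* §5 [folklore] INSTANCES: the typed packed resolvent (`blk_KInv_tt = Γ`, **`TOf_eq_ff_add_blockTerms`**, any `d`); the road's
  currency `d + 1 = 4`: `ffV_vertexOf` (the ff part of the chain-rule vertex IS `ReducedKernelF.vertexRedF` of the ff stencils, `rfl`),
  **`TOf_eq_TOfLeg_add_blockTerms`** (T8 junction: `TOf J = TOfLeg n Γ (S·ff) (W·ff) + blockTerms`), and for any packed letters
  **`hessKer_packK_eq_TOfLeg_add_blockTerms`**.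
NOT HERE (honest): the kernel-level (R2-a) objects `Γ_R`, `wH_R := Ga·Qᵀ·Cun` and the fm identification / slice property `R∂*·wH_R = 0`
(they need an operator equation for `Ga = Kinf` on `ℤ⁴`, which `GluonLeg`'s header records as not in the tree; torus form
`LandauMultiplierIdentities.R_div_G_QvAdj_eq_zero`, passage = node V1); any estimate of the block terms (A3.d / A5).
Unit `b2b-balaban-beta-d1-formalise-leaf-03` (gen 2), D1 formalisation swarm.
-/

noncomputable section

namespace Summit.QuantumFields.BalabanUV.Beta.D1BFx.PackedKernelSplit

open Finset
open scoped BigOperators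
open Literature.MathematicalPhysics.QuantumFieldTheory.Balaban1983to89
open Literature.MathematicalPhysics.QuantumFieldTheory.Balaban1983to89.Beta
open B12Sec2to5 (l1 l1_nonneg)
open ExpKernelCalculus (Site MKer Decays BiLoc VertexFamily VertexFamily₂ comp tr bubble tadpole hessKer)
open KernelWard (Bdd)
open OneStepResolventKernel (Fib KInv wsum vertexOf JetData TOf decays_KInv vertexFamily_vertexOf')
open Summit.QuantumFields.BalabanUV.Beta.TameKernelCalculus
open Summit.QuantumFields.BalabanUV.Beta.D1BFx.ReducedKernelF (vertexRedF TOfLeg TOfLeg_eq)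

variable {D : ℕ} {F : Type*}

/-! ## §1 Block readers, the packer, inheritance of the kernel classes -/

/-- [our object] **SIDE INJECTION** of the packed fibre `F ⊕ F`: `inj true = Sum.inl` (field leg), `inj false = Sum.inr` (multiplier leg). -/
def inj : Bool → F → F ⊕ F
  | true => Sum.inl
  | false => Sum.inr

/-- [our object] **BLOCK READER**: `blk K i j` = the `(i, j)`-block of a packed kernel (`true` = field, `false` = multiplier); so
`blk K true true` = ff, `blk K true false` = fm, `blk K false true` = mf, `blk K false false` = mm. -/
def blk (K : MKer D (F ⊕ F)) (i j : Bool) : MKer D F := fun x z a b => K x z (inj i a) (inj j b)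

/-- [our object] The ff block, entrywise. -/
theorem blk_tt (K : MKer D (F ⊕ F)) (x z : Site D) (a b : F) : blk K true true x z a b = K x z (Sum.inl a) (Sum.inl b) := rfl
/-- [our object] The fm block, entrywise. -/
theorem blk_tf (K : MKer D (F ⊕ F)) (x z : Site D) (a b : F) : blk K true false x z a b = K x z (Sum.inl a) (Sum.inr b) := rfl
/-- [our object] The mf block, entrywise. -/
theorem blk_ft (K : MKer D (F ⊕ F)) (x z : Site D) (a b : F) : blk K false true x z a b = K x z (Sum.inr a) (Sum.inl b) := rfl
/-- [our object] The mm block, entrywise. -/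
theorem blk_ff (K : MKer D (F ⊕ F)) (x z : Site D) (a b : F) : blk K false false x z a b = K x z (Sum.inr a) (Sum.inr b) := rfl

/-- [our object] **THE PACKER**: the packed kernel with prescribed blocks `(ff, fm, mf, mm) = (Kff, Kfm, Kmf, Kmm)`.  Under (R2-a) the
R-weighted packed kernel of road BF-x is `packK Γ_R H Hᵀ Φ` with the typed `H`/`Hᵀ`/`Φ` blocks and the owner's ff letter `Γ_R`.  A DEFINITION;
asserts nothing. -/
def packK (Kff Kfm Kmf Kmm : MKer D F) : MKer D (F ⊕ F) := fun x z a b =>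
  match a, b with
  | Sum.inl a, Sum.inl b => Kff x z a b
  | Sum.inl a, Sum.inr b => Kfm x z a b
  | Sum.inr a, Sum.inl b => Kmf x z a b
  | Sum.inr a, Sum.inr b => Kmm x z a b

/-- [our object] Reading back the ff block of the packer. -/
@[simp] theorem blk_packK_tt (Kff Kfm Kmf Kmm : MKer D F) : blk (packK Kff Kfm Kmf Kmm) true true = Kff := rfl
/-- [our object] Reading back the fm block of the packer. -/
@[simp] theorem blk_packK_tf (Kff Kfm Kmf Kmm : MKer D F) : blk (packK Kff Kfm Kmf Kmm) true false = Kfm := rfl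
/-- [our object] Reading back the mf block of the packer. -/
@[simp] theorem blk_packK_ft (Kff Kfm Kmf Kmm : MKer D F) : blk (packK Kff Kfm Kmf Kmm) false true = Kmf := rfl
/-- [our object] Reading back the mm block of the packer. -/
@[simp] theorem blk_packK_ff (Kff Kfm Kmf Kmm : MKer D F) : blk (packK Kff Kfm Kmf Kmm) false false = Kmm := rfl

/-- [our object] A packed kernel IS the packing of its four blocks. -/
theorem packK_blk (K : MKer D (F ⊕ F)) :
    packK (blk K true true) (blk K true false) (blk K false true) (blk K false false) = K := by
  funext x z a b
  cases a <;> cases b <;> rfl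

/-- [folklore] A `Decays` bound passes to every block. -/
theorem decays_blk {K : MKer D (F ⊕ F)} {C δ : ℝ} (h : Decays K C δ) (i j : Bool) : Decays (blk K i j) C δ :=
  fun x y a b => h x y (inj i a) (inj j b)

/-- [folklore] A `BiLoc` bound passes to every block. -/
theorem biLoc_blk {K : MKer D (F ⊕ F)} {p q : Site D} {C δ : ℝ} (h : BiLoc K p q C δ) (i j : Bool) : BiLoc (blk K i j) p q C δ :=
  fun x y a b => h x y (inj i a) (inj j b)

/-- [folklore] Blocks of a spread kernel are spread. -/
theorem spr_blk {K : MKer D (F ⊕ F)} (h : Spr K) (i j : Bool) :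
    Spr (blk K i j) := by
  obtain ⟨C, δ, hδ, hK⟩ := h
  exact ⟨C, δ, hδ, decays_blk hK i j⟩

/-- [folklore] Blocks of a localised kernel are localised (at the same points). -/
theorem loc_blk {K : MKer D (F ⊕ F)} (h : Loc K) (i j : Bool) :
    Loc (blk K i j) := by
  obtain ⟨p, q, C, δ, hδ, hK⟩ := h
  exact ⟨p, q, C, δ, hδ, biLoc_blk hK i j⟩

/-- [folklore] Blocks of a tame kernel are tame (the same majorants). -/
theorem tame_blk {K : MKer D (F ⊕ F)} (h : Tame K) (i j : Bool) :
    Tame (blk K i j) := by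
  obtain ⟨hr, hc, B, hB⟩ := h
  refine ⟨fun x => ?_, fun z => ?_, ⟨B, fun x y a b => hB x y (inj i a) (inj j b)⟩⟩
  · obtain ⟨φ, hφ, hφ0, hle⟩ := hr x
    exact ⟨φ, hφ, hφ0, fun y a f => hle y (inj i a) (inj j f)⟩
  · obtain ⟨ψ, hψ, hψ0, hle⟩ := hc z
    exact ⟨ψ, hψ, hψ0, fun y f b => hle y (inj i f) (inj j b)⟩

/-- [folklore] Packing four kernels with a common `Decays` bound gives a packed kernel with that bound. -/
theorem decays_packK {Kff Kfm Kmf Kmm : MKer D F} {C δ : ℝ} (h1 : Decays Kff C δ) (h2 : Decays Kfm C δ) (h3 : Decays Kmf C δ)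
    (h4 : Decays Kmm C δ) : Decays (packK Kff Kfm Kmf Kmm) C δ := by
  intro x y a b
  cases a <;> cases b
  · exact h1 x y _ _
  · exact h2 x y _ _
  · exact h3 x y _ _
  · exact h4 x y _ _

/-- [folklore] Weakening a `Decays` bound to a larger constant and a smaller rate (generic dimension). -/
theorem decays_weaken {A : MKer D F} {C C' δ δ' : ℝ} (h : Decays A C δ) (hC : |C| ≤ C') (hδ : δ' ≤ δ) : Decays A C' δ' :=
  fun x y a b => ((decays_of_le h hδ) x y a b).trans (mul_le_mul_of_nonneg_right hC (Real.exp_pos _).le)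

/-- [folklore] Packing four SPREAD kernels gives a spread packed kernel (common rate = the minimum, common constant = the sum of `|Cᵢ|`). -/
theorem spr_packK {Kff Kfm Kmf Kmm : MKer D F} (h1 : Spr Kff) (h2 : Spr Kfm) (h3 : Spr Kmf) (h4 : Spr Kmm) :
    Spr (packK Kff Kfm Kmf Kmm) := by
  obtain ⟨C₁, δ₁, hδ₁, e1⟩ := h1
  obtain ⟨C₂, δ₂, hδ₂, e2⟩ := h2
  obtain ⟨C₃, δ₃, hδ₃, e3⟩ := h3
  obtain ⟨C₄, δ₄, hδ₄, e4⟩ := h4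
  set δ : ℝ := min (min δ₁ δ₂) (min δ₃ δ₄) with hδdef
  set C : ℝ := |C₁| + |C₂| + |C₃| + |C₄| with hCdef
  have a1 := abs_nonneg C₁; have a2 := abs_nonneg C₂; have a3 := abs_nonneg C₃; have a4 := abs_nonneg C₄
  refine ⟨C, δ, lt_min (lt_min hδ₁ hδ₂) (lt_min hδ₃ hδ₄), decays_packK ?_ ?_ ?_ ?_⟩
  · exact decays_weaken e1 (by rw [hCdef]; linarith) ((min_le_left _ _).trans (min_le_left _ _))
  · exact decays_weaken e2 (by rw [hCdef]; linarith) ((min_le_left _ _).trans (min_le_right _ _))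
  · exact decays_weaken e3 (by rw [hCdef]; linarith) ((min_le_right _ _).trans (min_le_left _ _))
  · exact decays_weaken e4 (by rw [hCdef]; linarith) ((min_le_right _ _).trans (min_le_right _ _))

/-- [our object] **THE ff PART OF A PACKED FIRST-ORDER VERTEX FAMILY**. -/
def ffV (V : Fin D → Site D → MKer D (F ⊕ F)) : Fin D → Site D → MKer D F := fun μ y => blk (V μ y) true true

/-- [our object] **THE ff PART OF A PACKED SECOND-ORDER VERTEX FAMILY**. -/
def ffW (W : Fin D → Site D → Fin D → Site D → MKer D (F ⊕ F)) : Fin D → Site D → Fin D → Site D → MKer D F :=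
  fun μ y ν y' => blk (W μ y ν y') true true

/-- [our object] Unfolding `ffV`. -/
theorem ffV_apply (V : Fin D → Site D → MKer D (F ⊕ F)) (μ : Fin D) (y : Site D) : ffV V μ y = blk (V μ y) true true := rfl
/-- [our object] Unfolding `ffW`. -/
theorem ffW_apply (W : Fin D → Site D → Fin D → Site D → MKer D (F ⊕ F)) (μ : Fin D) (y : Site D) (ν : Fin D) (y' : Site D) :
    ffW W μ y ν y' = blk (W μ y ν y') true true := rfl

/-- [our object] **THE TWO-LEG BUBBLE** `biBubble A V B W := tr ((A ∘ V) ∘ (B ∘ W))` — the bubble with possibly different legs on the two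
propagator lines (the words of the block expansion).  `bubble A V W = biBubble A V A W` definitionally. -/
def biBubble [Fintype F] (A V B W : MKer D F) : ℝ := tr (comp (comp A V) (comp B W))

/-- [folklore] The one-leg bubble is the diagonal of the two-leg bubble. -/
theorem bubble_eq_biBubble [Fintype F] (A V W : MKer D F) : bubble A V W = biBubble A V A W := rfl

/-! ## §2 Fubini over the fibre: block rules for `comp`, `tr`, `tadpole`, `bubble` -/

section Fubini

variable [Fintype F]

/-- [folklore] **BLOCK RULE FOR COMPOSITION** (tame factors): `(A ∘ B)_{ik} = A_{i,f} ∘ B_{f,k} + A_{i,m} ∘ B_{m,k}` — the fibre sum over `F ⊕ F`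
splits (`Fintype.sum_sum_type`) and the site series splits termwise (`slices_tame`). -/
theorem blk_comp {A B : MKer D (F ⊕ F)} (hA : Tame A) (hB : Tame B) (i k : Bool) :
    blk (comp A B) i k = comp (blk A i true) (blk B true k) + comp (blk A i false) (blk B false k) := by
  funext x z a b
  have h1 := slices_tame (tame_blk hA i true) (tame_blk hB true k) x z a b
  have h2 := slices_tame (tame_blk hA i false) (tame_blk hB false k) x z a b
  simp only [blk] at h1 h2
  simp only [blk, comp, Pi.add_apply]
  rw [← h1.tsum_add h2]
  exact tsum_congr fun y => Fintype.sum_sum_type _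

/-- [folklore] **BLOCK RULE FOR THE TRACE** (localised kernel): `tr K = tr K_ff + tr K_mm`. -/
theorem tr_eq_blk {K : MKer D (F ⊕ F)} (hK : Loc K) : tr K = tr (blk K true true) + tr (blk K false false) := by
  simp only [tr]
  rw [← (loc_blk hK true true).summable_tr.tsum_add (loc_blk hK false false).summable_tr]
  exact tsum_congr fun x => Fintype.sum_sum_type _

/-- [folklore] The trace of a composition of tame packed kernels whose block words are localised is the sum of the four diagonal block
words: `tr (P ∘ Q) = Σ_{i,k} tr (P_{ik} ∘ Q_{ki})`. -/
theorem tr_comp_eq_blk_sum {P Q : MKer D (F ⊕ F)} (hP : Tame P) (hQ : Tame Q) (hPQ : Loc (comp P Q))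
    (h : ∀ i k, Loc (comp (blk P i k) (blk Q k i))) :
    tr (comp P Q) = ∑ i : Bool, ∑ k : Bool, tr (comp (blk P i k) (blk Q k i)) := by
  rw [tr_eq_blk hPQ, blk_comp hP hQ, blk_comp hP hQ, tr_add_loc (h _ _) (h _ _), tr_add_loc (h _ _) (h _ _)]
  simp only [Fintype.sum_bool]

/-- [folklore] **BLOCK EXPANSION OF THE TADPOLE** (spread `K`, localised `W`): `tadpole K W = Σ_{i,j} tadpole K_{ij} W_{ji}` (4 words). -/
theorem tadpole_eq_blk_sum {K W : MKer D (F ⊕ F)} (hK : Spr K) (hW : Loc W) :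
    tadpole K W = ∑ i : Bool, ∑ j : Bool, tadpole (blk K i j) (blk W j i) := by
  simp only [tadpole]
  exact tr_comp_eq_blk_sum hK.tame hW.tame (hK.comp_loc hW) fun i k => (spr_blk hK i k).comp_loc (loc_blk hW k i)

/-- [folklore] `tr ((A₁ + A₂) ∘ (B₁ + B₂))` = the four words, for localised kernels. -/
theorem tr_comp_add_add {A₁ A₂ B₁ B₂ : MKer D F} (h1 : Loc A₁) (h2 : Loc A₂) (h3 : Loc B₁) (h4 : Loc B₂) :
    tr (comp (A₁ + A₂) (B₁ + B₂)) =
      tr (comp A₁ B₁) + tr (comp A₁ B₂) + (tr (comp A₂ B₁) + tr (comp A₂ B₂)) := by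
  rw [comp_add_left_tame h1.tame h2.tame (h3.add h4).tame, comp_add_right_tame h1.tame h3.tame h4.tame,
    comp_add_right_tame h2.tame h3.tame h4.tame,
    tr_add_loc ((h1.comp h3).add (h1.comp h4)) ((h2.comp h3).add (h2.comp h4)),
    tr_add_loc (h1.comp h3) (h1.comp h4), tr_add_loc (h2.comp h3) (h2.comp h4)]

/-- [folklore] **BLOCK EXPANSION OF THE BUBBLE** (spread `K`, localised `V`, `W`):
`bubble K V W = Σ_{i,j,k,l} biBubble K_{ij} V_{jk} K_{kl} W_{li}` (16 words). -/
theorem bubble_eq_blk_sum {K V W : MKer D (F ⊕ F)} (hK : Spr K) (hV : Loc V) (hW : Loc W) :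
    bubble K V W = ∑ i : Bool, ∑ j : Bool, ∑ k : Bool, ∑ l : Bool,
      biBubble (blk K i j) (blk V j k) (blk K k l) (blk W l i) := by
  have hP : Loc (comp K V) := hK.comp_loc hV
  have hQ : Loc (comp K W) := hK.comp_loc hW
  have e1 := tr_comp_eq_blk_sum hP.tame hQ.tame (hP.comp hQ) fun i k => (loc_blk hP i k).comp (loc_blk hQ k i)
  simp only [bubble]
  rw [e1]
  refine Finset.sum_congr rfl fun i _ => ?_
  rw [Finset.sum_comm]
  refine Finset.sum_congr rfl fun k _ => ?_
  have wij : ∀ i' j' k', Loc (comp (blk K i' j') (blk V j' k')) := fun i' j' k' => (spr_blk hK i' j').comp_loc (loc_blk hV j' k')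
  have wkl : ∀ k' l' i', Loc (comp (blk K k' l') (blk W l' i')) := fun k' l' i' => (spr_blk hK k' l').comp_loc (loc_blk hW l' i')
  rw [blk_comp hK.tame hV.tame, blk_comp hK.tame hW.tame,
    tr_comp_add_add (wij i true k) (wij i false k) (wkl k true i) (wkl k false i)]
  simp only [Fintype.sum_bool, biBubble]

end Fubini

/-! ## §3 The displayed block terms and the split of the resolvent Hessian kernel -/

section Split

variable [Fintype F]

/-- [our object] **THE BLOCK TERMS** of the resolvent Hessian kernel of a packed kernel `K` with packed vertex families `V`, `W` at the
coarse bond pair `(μ, 0), (ν, z)`: `½ ·` (the 3 tadpole words `tadpole K_{ij} (W μ 0 ν z)_{ji}` with `(i,j) ≠ (f,f)`) `− ½ ·` (the 15 bubble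
words `biBubble K_{ij} (V μ 0)_{jk} K_{kl} (V ν z)_{li}` with `(i,j,k,l) ≠ (f,f,f,f)`), displayed as guarded finite sums over the sides.
Every word contains at least one fm/mf block of `K` (an `ℋ`-leg) or the mm block (a multiplier leg).  A DEFINITION; asserts nothing. -/
def blockTerms (K : MKer D (F ⊕ F)) (V : Fin D → Site D → MKer D (F ⊕ F)) (W : Fin D → Site D → Fin D → Site D → MKer D (F ⊕ F))
    (μ ν : Fin D) (z : Site D) : ℝ :=
  (1 / 2) * (∑ i : Bool, ∑ j : Bool, bif (i && j) then 0 else tadpole (blk K i j) (blk (W μ 0 ν z) j i))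
    - (1 / 2) * (∑ i : Bool, ∑ j : Bool, ∑ k : Bool, ∑ l : Bool,
        bif (i && j && k && l) then 0 else biBubble (blk K i j) (blk (V μ 0) j k) (blk K k l) (blk (V ν z) l i))

/-- [folklore] **THE TERM SPLIT OF THE ONE-LOOP KERNEL OF A PACKED RESOLVENT** (spread `K`; every vertex and table entry localised):
`hessKer K V W μ ν z = hessKer K_ff V_ff W_ff μ ν z + blockTerms K V W μ ν z` — TYPER-SPEC §2 K-R2's «CONSEQUENCE … by pure substitution»
in the (R2-a) reading, for ANY ff letter. -/
theorem hessKer_eq_ff_add_blockTerms {K : MKer D (F ⊕ F)} (hK : Spr K) {V : Fin D → Site D → MKer D (F ⊕ F)}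
    (hV : ∀ μ y, Loc (V μ y)) {W : Fin D → Site D → Fin D → Site D → MKer D (F ⊕ F)} (hW : ∀ μ y ν y', Loc (W μ y ν y'))
    (μ ν : Fin D) (z : Site D) :
    hessKer K V W μ ν z = hessKer (blk K true true) (ffV V) (ffW W) μ ν z + blockTerms K V W μ ν z := by
  simp only [hessKer, blockTerms, ffV, ffW]
  rw [tadpole_eq_blk_sum hK (hW μ 0 ν z), bubble_eq_blk_sum hK (hV μ 0) (hV ν z), bubble_eq_biBubble]
  simp only [Fintype.sum_bool, Bool.true_and, Bool.false_and, cond_true, cond_false]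
  ring

end Split

/-! ## §4 Additivity in the leg -/

section Leg

variable [Fintype F]

/-- [our object] **THE CROSS WORDS OF A SPLIT LEG** `A + B`: `½·tadpole B W − ½·(biBubble A V B V′ + biBubble B V A V′ + biBubble B V B V′)` at the
bond pair `(μ,0), (ν,z)`.  A DEFINITION; asserts nothing. -/
def legCross (A B : MKer D F) (V : Fin D → Site D → MKer D F) (W : Fin D → Site D → Fin D → Site D → MKer D F)
    (μ ν : Fin D) (z : Site D) : ℝ :=
  (1 / 2) * tadpole B (W μ 0 ν z)
    - (1 / 2) * (biBubble A (V μ 0) B (V ν z) + (biBubble B (V μ 0) A (V ν z) + biBubble B (V μ 0) B (V ν z)))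

/-- [folklore] **ADDITIVITY OF THE RESOLVENT HESSIAN KERNEL IN THE LEG** (spread `A`, `B`; localised entries):
`hessKer (A + B) V W μ ν z = hessKer A V W μ ν z + legCross A B V W μ ν z` — e.g. `Γ_R = Ga + (−Ga·Qᵀ·Cun·Q·Ga)` under (R2-a): the first
summand is T8's `TOfRed`-shape over `Ga`, the cross words carry a `Q·Ga` leg (block-structured). -/
theorem hessKer_add_leg {A B : MKer D F} (hA : Spr A) (hB : Spr B) {V : Fin D → Site D → MKer D F} (hV : ∀ μ y, Loc (V μ y))
    {W : Fin D → Site D → Fin D → Site D → MKer D F} (hW : ∀ μ y ν y', Loc (W μ y ν y')) (μ ν : Fin D) (z : Site D) :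
    hessKer (A + B) V W μ ν z = hessKer A V W μ ν z + legCross A B V W μ ν z := by
  have hAt := hA.tame
  have hBt := hB.tame
  have eT : tadpole (A + B) (W μ 0 ν z) = tadpole A (W μ 0 ν z) + tadpole B (W μ 0 ν z) := by
    simp only [tadpole]
    rw [comp_add_left_tame hAt hBt (hW μ 0 ν z).tame, tr_add_loc (hA.comp_loc (hW μ 0 ν z)) (hB.comp_loc (hW μ 0 ν z))]
  have eB : bubble (A + B) (V μ 0) (V ν z) =
      biBubble A (V μ 0) A (V ν z) + biBubble A (V μ 0) B (V ν z) + (biBubble B (V μ 0) A (V ν z) + biBubble B (V μ 0) B (V ν z)) := by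
    simp only [bubble, biBubble]
    rw [comp_add_left_tame hAt hBt (hV μ 0).tame, comp_add_left_tame hAt hBt (hV ν z).tame,
      tr_comp_add_add (hA.comp_loc (hV μ 0)) (hB.comp_loc (hV μ 0)) (hA.comp_loc (hV ν z)) (hB.comp_loc (hV ν z))]
  simp only [hessKer, legCross]
  rw [eT, eB, bubble_eq_biBubble]
  ring

end Leg

/-! ## §5 Instances: the typed packed resolvent; the road's currency `d + 1 = 4` and the T8 junction -/

section Typed

variable {d N : ℕ} [NeZero N]

/-- [folklore] The ff block of the typed packed resolvent is the fluctuation covariance `Γ` (`OneStepResolventKernel.KInv_inl_inl`). -/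
theorem blk_KInv_tt (x y : Fin (d + 1) → ℤ) (κ l : Fin (d + 1)) :
    blk (KInv (N := N) (d := d)) true true x y κ l = KKTFluctuationKernel.Gam (N := N) κ x l y := rfl

/-- [folklore] Every chain-rule vertex of a jet datum is localised (`vertexFamily_vertexOf'`). -/
theorem loc_vertexOf (J : JetData d N) (μ : Fin (d + 1)) (y : Fin (d + 1) → ℤ) : Loc (vertexOf (N := N) J.S μ y) := by
  obtain ⟨Cv, δv, hδv, hV⟩ := vertexFamily_vertexOf' (N := N) J.loc J.δ_pos
  exact ⟨_, _, Cv, δv, hδv, hV μ y⟩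

omit [NeZero N] in
/-- [folklore] Every second-order vertex of a jet datum is localised (`JetData.loc₂`). -/
theorem loc_W (J : JetData d N) (μ : Fin (d + 1)) (y : Fin (d + 1) → ℤ) (ν : Fin (d + 1)) (y' : Fin (d + 1) → ℤ) :
    Loc (J.W μ y ν y') :=
  ⟨_, _, J.Cw, J.δ, J.δ_pos, J.loc₂ μ y ν y'⟩

/-- [folklore] **THE TYPED ONE-SHOT KERNEL, SPLIT** (any dimension, any blocking): `TOf J μ ν z = hessKer Γ (vertexOf J.S)·ff (J.W)·ff μ ν z +
blockTerms KInv (vertexOf J.S) J.W μ ν z` — NO hypothesis (the typed resolvent is spread — `OneStepResolventKernel.decays_KInv`, packaged as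
`Spr` exactly as the tree's `BorderedHessian.spr_KInv` (not imported: wall cone) — and the jet data are localised by definition). -/
theorem TOf_eq_ff_add_blockTerms (J : JetData d N) (μ ν : Fin (d + 1)) (z : Fin (d + 1) → ℤ) :
    TOf (N := N) J μ ν z =
      hessKer (blk (KInv (N := N) (d := d)) true true) (ffV (vertexOf (N := N) J.S)) (ffW J.W) μ ν z +
        blockTerms (KInv (N := N) (d := d)) (vertexOf (N := N) J.S) J.W μ ν z := by
  obtain ⟨δ, C, hδ, -, h⟩ := decays_KInv (N := N) (d := d)
  exact hessKer_eq_ff_add_blockTerms ⟨C, δ, hδ, h⟩ (loc_vertexOf J) (loc_W J) μ ν z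

end Typed

section Four

variable (n : ℕ) [NeZero n]

/-- [folklore] **THE ff PART OF THE CHAIN-RULE VERTEX IS THE REDUCED VERTEX OF THE ff STENCILS** (`d + 1 = 4`): `(vertexOf S μ y)·ff =
vertexRedF n (S·ff) μ y` — the `ℋ`-weights are the same `KernelSpecInstance.wH`; definitional. -/
theorem ffV_vertexOf (S : Fin 4 → Site 4 → MKer 4 (Fib 3)) :
    ffV (vertexOf (d := 3) (N := n) S) = vertexRedF n (fun κ u => blk (S κ u) true true) := by
  funext μ y x z a b
  rfl

/-- [folklore] Hence the ff part of the one-loop kernel over any ff letter `Γ` is T8's dressed kernel over the leg `Γ`: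
`hessKer Γ (vertexOf S)·ff W·ff = TOfLeg n Γ (S·ff) (W·ff)` (`ReducedKernelF.TOfLeg`). -/
theorem hessKer_ffV_vertexOf_eq_TOfLeg (Γ : MKer 4 (Fin 4)) (S : Fin 4 → Site 4 → MKer 4 (Fib 3))
    (W : Fin 4 → Site 4 → Fin 4 → Site 4 → MKer 4 (Fib 3)) :
    hessKer Γ (ffV (vertexOf (d := 3) (N := n) S)) (ffW W) = TOfLeg n Γ (fun κ u => blk (S κ u) true true) (ffW W) := by
  rw [TOfLeg_eq, ffV_vertexOf]

/-- [folklore] **T8 JUNCTION FOR THE TYPED KERNEL** (`d + 1 = 4`): `TOf J μ ν z = TOfLeg n Γ (J.S·ff) (J.W·ff) μ ν z + blockTerms KInv (vertexOf J.S) J.W μ ν z`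
with `Γ = KInv·ff` the typed fluctuation covariance — NO hypothesis. -/
theorem TOf_eq_TOfLeg_add_blockTerms (J : JetData 3 n) (μ ν : Fin 4) (z : Site 4) :
    TOf (N := n) J μ ν z =
      TOfLeg n (blk (KInv (N := n) (d := 3)) true true) (fun κ u => blk (J.S κ u) true true) (ffW J.W) μ ν z +
        blockTerms (KInv (N := n) (d := 3)) (vertexOf (N := n) J.S) J.W μ ν z := by
  rw [TOf_eq_ff_add_blockTerms, hessKer_ffV_vertexOf_eq_TOfLeg]

/-- [folklore] **T8 JUNCTION FOR ANY PACKED LETTERS** (`d + 1 = 4`; the (R2-a) shape): for spread letters `Γ H Φ M` and a localised stencil /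
table family, `hessKer (packK Γ H Φ M) (vertexOf S) W μ ν z = TOfLeg n Γ (S·ff) (W·ff) μ ν z + blockTerms (packK Γ H Φ M) (vertexOf S) W μ ν z`. -/
theorem hessKer_packK_eq_TOfLeg_add_blockTerms {Γ H Φ M : MKer 4 (Fin 4)} (hΓ : Spr Γ) (hH : Spr H) (hΦ : Spr Φ) (hM : Spr M)
    {S : Fin 4 → Site 4 → MKer 4 (Fib 3)} (hS : ∀ μ y, Loc (vertexOf (d := 3) (N := n) S μ y))
    {W : Fin 4 → Site 4 → Fin 4 → Site 4 → MKer 4 (Fib 3)} (hW : ∀ μ y ν y', Loc (W μ y ν y')) (μ ν : Fin 4) (z : Site 4) :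
    hessKer (packK Γ H Φ M) (vertexOf (d := 3) (N := n) S) W μ ν z =
      TOfLeg n Γ (fun κ u => blk (S κ u) true true) (ffW W) μ ν z + blockTerms (packK Γ H Φ M) (vertexOf (d := 3) (N := n) S) W μ ν z := by
  rw [hessKer_eq_ff_add_blockTerms (spr_packK hΓ hH hΦ hM) hS hW, blk_packK_tt, hessKer_ffV_vertexOf_eq_TOfLeg]

end Four

end Summit.QuantumFields.BalabanUV.Beta.D1BFx.PackedKernelSplit

end
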